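import Summits.CriticalPhenomena.PercolationContinuityZ3.Theorems.PercNearOneGluingNoHeavyLowerTailSunflowerAntipodalGladkov
import Mathlib.Data.Fintype.Option
import Mathlib.Algebra.BigOperators.Option
import HarnessLib

/-!
# `NoHeavyLowerTail` (crux stmt-CriticalPhenomena-4575), abstract sunflower cubic: the CLONE CALCULUS of three-copy functionals
# (delete / keep / duplicate / contract a coordinate), kernel-generic

Support file (seat `prim-l12-p2` gen 6; `--supports stmt-CriticalPhenomena-4575`).  Nothing is asserted about the crux; no `sorry`, no named facts.
Memo: run/shared/lean/prim/prim-l12/prim-l12-p2/FINDING-g6-COMPOSITION-IDENTITY.md.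

PURPOSE.  prim-ineq-prove-1 (gen 25) reduced the last open cubic three- and four-point rows (`H_{q+t}`, `γ`, `G₄`, and new proofs of AG⁺, `T_inc`,
3PT-LB) to ONE counting statement about monotone maps `2^E → M₃` (`SunflowerPartition.Sunflower`): the PARTITION LEMMA
`Σ_{ordered 3-partitions} s6H ≥ 0`.  The passage "partition lemma ⇒ law-level cubic for every product measure" was a limiting (cloning, `d → ∞`)
argument on paper.  This file and its companion `…SunflowerCloneTransfer` replace it by an EXACT FINITE IDENTITY, formalised kernel-generically.

THE FUNCTIONAL.  Three copies of a configuration are encoded coordinate-wise by a PATTERN `β e : Bool × Bool × Bool` (which of the three copies contain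
`e`); copy `k` is `blocks β k = {e | bit (β e) k}`.  For a kernel `κ : Fin 5 → Fin 5 → Fin 5 → ℝ` on label triples, a labelling `lab : Finset E → Fin 5`
and per-coordinate pattern weights `ω e : Pat → ℝ`,
  `Mk κ lab ω = Σ_β (∏_e ω e (β e)) · κ (lab (blocks β 0)) (lab (blocks β 1)) (lab (blocks β 2))`.
Weight menus: `cl1` (exactly one copy — an ordered-3-partition coordinate), `cl0` (no copy: `e` deleted), `clU` (all copies: `e` contracted),
`uconv w₁ w₂` (union-convolution: `e` duplicated into twins weighted `w₁, w₂`), and in the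
companion file the Bernoulli weight `∏_k (p if bit k else 1 − p)` (three INDEPENDENT copies under the product measure).  With `ω ≡ cl1`, `Mk` is the
partition functional `Zk` (for `κ = s6H` it is prove-1's `ZH`, proved in `…SunflowerCloneHqt`).

IDENTITIES (all kernel-generic, all labellings):
* `Mk_update_eq_sum` — expansion at one coordinate: `Mk κ lab (ω[e ↦ u]) = Σ_B u B · Ψ_e B`; hence linearity `Mk_update_lin`.
* `Mk_erase_cl1`  — DELETE:    `Mk κ (lab ∘ erase e) (ω[e ↦ cl1]) = 3 · Mk κ lab (ω[e ↦ cl0])`.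
* `Mk_insert_cl1` — CONTRACT:  `Mk κ (lab ∘ insert e) (ω[e ↦ cl1]) = 3 · Mk κ lab (ω[e ↦ clU])`.
* `Mk_dup`        — DUPLICATE: on `Option E` with `none` a twin of `e` (`mergeOpt e`), weights `w₁` on the twin and `w₂` on `e`:
                    `Mk κ (lab ∘ mergeOpt e) ω̂ = Mk κ lab (ω[e ↦ uconv w₁ w₂])`.
The companion file adds the sunflower operations (`Sunflower.del/con/dup/reindex`, monotone pull-backs) and turns these into: (partition lemma for `κ` on all finite sunflowers) ⇒ (three-independent-copies expectation of `κ` ≥ 0 for every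
product measure), by an induction whose only type change is `E ↦ Option E`.
-/

namespace Summit.CriticalPhenomena.PercolationContinuityZ3.Theorems.SunflowerPartition

open Finset

/-- A coordinate's PATTERN across the three copies: three Booleans (is it in copy 0 / 1 / 2). [this work] -/
abbrev Pat := Bool × Bool × Bool

namespace Pat

/-- The `k`-th bit of a pattern. [this work] -/
def bit (B : Pat) : Fin 3 → Bool := ![B.1, B.2.1, B.2.2]
/-- The empty pattern (in no copy). [this work] -/
def nil : Pat := (false, false, false)
/-- The full pattern (in all three copies). [this work] -/
def full : Pat := (true, true, true)
/-- Componentwise union ("or") of patterns. [this work] -/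
def union (B C : Pat) : Pat := (B.1 || C.1, B.2.1 || C.2.1, B.2.2 || C.2.2)
/-- "Exactly one copy" (Boolean test). [this work] -/
def isSingle : Pat → Bool
  | (true, false, false) => true
  | (false, true, false) => true
  | (false, false, true) => true
  | _ => false

/-- Bit `0`. [this work] -/
@[simp] theorem bit_zero (B : Pat) : B.bit 0 = B.1 := rfl
/-- Bit `1`. [this work] -/
@[simp] theorem bit_one (B : Pat) : B.bit 1 = B.2.1 := rfl
/-- Bit `2`. [this work] -/
@[simp] theorem bit_two (B : Pat) : B.bit 2 = B.2.2 := rfl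
/-- Bits of `nil`. [this work] -/
@[simp] theorem bit_nil (k : Fin 3) : nil.bit k = false := by
  fin_cases k <;> rfl
/-- Bits of `full`. [this work] -/
@[simp] theorem bit_full (k : Fin 3) : full.bit k = true := by
  fin_cases k <;> rfl
/-- Bits of a union. [this work] -/
@[simp] theorem bit_union (B C : Pat) (k : Fin 3) : (B.union C).bit k = (B.bit k || C.bit k) := by
  fin_cases k <;> rfl

end Pat

section Functional

variable {E : Type*} [Fintype E] [DecidableEq E]

/-- Copy `k` of a pattern assignment: the coordinates whose pattern has bit `k`. [this work] -/
def blocks (β : E → Pat) (k : Fin 3) : Finset E := univ.filter fun e => (β e).bit k = true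

omit [DecidableEq E] in
/-- Membership in a block. [this work] -/
@[simp] theorem mem_blocks (β : E → Pat) (k : Fin 3) (e : E) : e ∈ blocks β k ↔ (β e).bit k = true := by
  simp [blocks]

/-- The kernel-generic THREE-COPY FUNCTIONAL with per-coordinate pattern weights. [this work] -/
def Mk (κ : Fin 5 → Fin 5 → Fin 5 → ℝ) (lab : Finset E → Fin 5) (ω : E → Pat → ℝ) : ℝ :=
  ∑ β : E → Pat, (∏ e, ω e (β e)) * κ (lab (blocks β 0)) (lab (blocks β 1)) (lab (blocks β 2))

/-- Weight "exactly one copy" (an ordered-3-partition coordinate). [this work] -/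
def cl1 : Pat → ℝ := fun B => if B.isSingle then 1 else 0
/-- Weight "no copy" (a deleted coordinate). [this work] -/
def cl0 : Pat → ℝ := fun B => if B = Pat.nil then 1 else 0
/-- Weight "all three copies" (a contracted coordinate). [this work] -/
def clU : Pat → ℝ := fun B => if B = Pat.full then 1 else 0
/-- Union-convolution of two pattern weights (the weight of a coordinate with two twins). [this work] -/
def uconv (w₁ w₂ : Pat → ℝ) : Pat → ℝ := fun B => ∑ x : Pat × Pat, if x.1.union x.2 = B then w₁ x.1 * w₂ x.2 else 0

/-- The PARTITION FUNCTIONAL of the kernel `κ`: every coordinate in exactly one copy. [this work] -/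
def Zk (κ : Fin 5 → Fin 5 → Fin 5 → ℝ) (lab : Finset E → Fin 5) : ℝ := Mk κ lab fun _ => cl1

/-! ### Blocks under a one-coordinate update -/

/-- Blocks after changing the pattern of one coordinate. [this work] -/
theorem blocks_update (β : E → Pat) (e : E) (B : Pat) (k : Fin 3) :
    blocks (Function.update β e B) k = if B.bit k = true then insert e (blocks β k) else (blocks β k).erase e := by
  ext x
  by_cases hx : x = e
  · subst hx
    by_cases hk : B.bit k = true <;> simp [hk]
  · by_cases hk : B.bit k = true <;> simp [hk, hx]

omit [DecidableEq E] in
/-- A coordinate with empty pattern lies in no block. [this work] -/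
theorem not_mem_blocks_of_empty {β : E → Pat} {e : E} (h : β e = Pat.nil) (k : Fin 3) : e ∉ blocks β k := by
  simp [h]

/-- Blocks after giving an absent coordinate the pattern `B`, erased again. [this work] -/
theorem erase_blocks_update {β : E → Pat} {e : E} (h : β e = Pat.nil) (B : Pat) (k : Fin 3) :
    (blocks (Function.update β e B) k).erase e = blocks β k := by
  rw [blocks_update]
  have hk := not_mem_blocks_of_empty h k
  split_ifs
  · exact erase_insert hk
  · rw [erase_eq_of_notMem hk, erase_eq_of_notMem hk]

/-- Blocks after giving an absent coordinate the pattern `B`, with `e` inserted. [this work] -/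
theorem insert_blocks_update {β : E → Pat} {e : E} (h : β e = Pat.nil) (B : Pat) (k : Fin 3) :
    insert e (blocks (Function.update β e B) k) = blocks (Function.update β e Pat.full) k := by
  rw [blocks_update, blocks_update, if_pos (Pat.bit_full k)]
  have hk := not_mem_blocks_of_empty h k
  split_ifs
  · exact insert_idem e _
  · rw [erase_eq_of_notMem hk]

/-- Blocks are unchanged by re-assigning an absent coordinate the empty pattern. [this work] -/
theorem blocks_update_empty {β : E → Pat} {e : E} (h : β e = Pat.nil) (k : Fin 3) :
    blocks (Function.update β e Pat.nil) k = blocks β k := by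
  rw [blocks_update, if_neg (by simp), erase_eq_of_notMem (not_mem_blocks_of_empty h k)]

/-! ### Expansion of `Mk` at one coordinate -/

/-- The product of weights with one coordinate singled out. [this work] -/
theorem prod_update_eval (ω : E → Pat → ℝ) (e : E) (u : Pat → ℝ) (β : E → Pat) :
    ∏ x, (Function.update ω e u) x (β x) = u (β e) * ∏ x ∈ univ.erase e, ω x (β x) := by
  rw [← mul_prod_erase univ _ (mem_univ e), Function.update_self]
  congr 1
  refine prod_congr rfl fun x hx => ?_
  rw [Function.update_of_ne (ne_of_mem_erase hx)]

/-- Re-indexing a sum over pattern assignments with prescribed value at `e` by `Function.update`. [this work] -/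
theorem sum_ite_update (G : (E → Pat) → ℝ) (e : E) (B₁ B₂ : Pat) :
    ∑ β : E → Pat, (if β e = B₁ then G β else 0) = ∑ β : E → Pat, if β e = B₂ then G (Function.update β e B₁) else 0 := by
  rw [← sum_filter, ← sum_filter]
  refine sum_nbij' (fun β => Function.update β e B₂) (fun β => Function.update β e B₁) ?_ ?_ ?_ ?_ ?_
  · intro β _; simp
  · intro β _; simp
  · intro β hβ
    rw [mem_filter] at hβ
    rw [Function.update_idem, ← hβ.2, Function.update_eq_self]
  · intro β hβ
    rw [mem_filter] at hβ
    rw [Function.update_idem, ← hβ.2, Function.update_eq_self]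
  · intro β hβ
    rw [mem_filter] at hβ
    rw [Function.update_idem, ← hβ.2, Function.update_eq_self]

/-- The coordinate-`e` section functional `Ψ_e(B)`: patterns absent at `e`, re-assigned `B`, weights of the other coordinates. [this work] -/
def Psi (κ : Fin 5 → Fin 5 → Fin 5 → ℝ) (lab : Finset E → Fin 5) (ω : E → Pat → ℝ) (e : E) (B : Pat) : ℝ :=
  ∑ β : E → Pat, if β e = Pat.nil then (∏ x ∈ univ.erase e, ω x (β x)) *
    κ (lab (blocks (Function.update β e B) 0)) (lab (blocks (Function.update β e B) 1)) (lab (blocks (Function.update β e B) 2)) else 0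

/-- `Ψ_e` does not depend on the weight at `e`. [this work] -/
theorem Psi_update (κ : Fin 5 → Fin 5 → Fin 5 → ℝ) (lab : Finset E → Fin 5) (ω : E → Pat → ℝ) (e : E) (u : Pat → ℝ) (B : Pat) :
    Psi κ lab (Function.update ω e u) e B = Psi κ lab ω e B := by
  unfold Psi
  refine sum_congr rfl fun β _ => ?_
  congr 2
  refine prod_congr rfl fun x hx => ?_
  rw [Function.update_of_ne (ne_of_mem_erase hx)]

/-- **Expansion at one coordinate**: `Mk κ lab (ω[e ↦ u]) = Σ_B u B · Ψ_e B`. [this work] -/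
theorem Mk_update_eq_sum (κ : Fin 5 → Fin 5 → Fin 5 → ℝ) (lab : Finset E → Fin 5) (ω : E → Pat → ℝ) (e : E) (u : Pat → ℝ) :
    Mk κ lab (Function.update ω e u) = ∑ B : Pat, u B * Psi κ lab ω e B := by
  unfold Mk
  have step1 : ∀ β : E → Pat, (∏ x, (Function.update ω e u) x (β x)) *
      κ (lab (blocks β 0)) (lab (blocks β 1)) (lab (blocks β 2)) =
      ∑ B : Pat, if β e = B then u B * ((∏ x ∈ univ.erase e, ω x (β x)) *
        κ (lab (blocks β 0)) (lab (blocks β 1)) (lab (blocks β 2))) else 0 := by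
    intro β
    rw [sum_ite_eq, if_pos (mem_univ _), prod_update_eval, mul_assoc]
  rw [sum_congr rfl fun β _ => step1 β, sum_comm]
  refine sum_congr rfl fun B _ => ?_
  have step2 : ∀ β : E → Pat, (if β e = B then u B * ((∏ x ∈ univ.erase e, ω x (β x)) *
        κ (lab (blocks β 0)) (lab (blocks β 1)) (lab (blocks β 2))) else 0) =
      u B * (if β e = B then (∏ x ∈ univ.erase e, ω x (β x)) *
        κ (lab (blocks β 0)) (lab (blocks β 1)) (lab (blocks β 2)) else 0) := by
    intro β; split_ifs <;> simp
  rw [sum_congr rfl fun β _ => step2 β, ← mul_sum]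
  congr 1
  unfold Psi
  rw [sum_ite_update _ e B Pat.nil]
  refine sum_congr rfl fun β _ => ?_
  split_ifs with h
  · congr 1
    refine prod_congr rfl fun x hx => ?_
    rw [Function.update_of_ne (ne_of_mem_erase hx)]
  · rfl

/-- **Linearity** of `Mk` in the weight of one coordinate. [this work] -/
theorem Mk_update_lin (κ : Fin 5 → Fin 5 → Fin 5 → ℝ) (lab : Finset E → Fin 5) (ω : E → Pat → ℝ) (e : E)
    (w₁ w₂ : Pat → ℝ) (c₁ c₂ : ℝ) :
    Mk κ lab (Function.update ω e fun B => c₁ * w₁ B + c₂ * w₂ B) =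
      c₁ * Mk κ lab (Function.update ω e w₁) + c₂ * Mk κ lab (Function.update ω e w₂) := by
  rw [Mk_update_eq_sum, Mk_update_eq_sum, Mk_update_eq_sum, mul_sum, mul_sum, ← sum_add_distrib]
  refine sum_congr rfl fun B _ => ?_
  ring

/-- `Mk` with the weight at `e` replaced by its own value (bookkeeping). [this work] -/
theorem Mk_eq_update_self (κ : Fin 5 → Fin 5 → Fin 5 → ℝ) (lab : Finset E → Fin 5) (ω : E → Pat → ℝ) (e : E) :
    Mk κ lab ω = Mk κ lab (Function.update ω e (ω e)) := by
  rw [Function.update_eq_self]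

/-! ### Delete and contract -/

/-- The indicator weights pick out one value of `Ψ_e`. [this work] -/
theorem Mk_update_cl0 (κ : Fin 5 → Fin 5 → Fin 5 → ℝ) (lab : Finset E → Fin 5) (ω : E → Pat → ℝ) (e : E) :
    Mk κ lab (Function.update ω e cl0) = Psi κ lab ω e Pat.nil := by
  rw [Mk_update_eq_sum]
  simp only [cl0, ite_mul, one_mul, zero_mul, sum_ite_eq', mem_univ, if_true]

/-- The indicator weights pick out one value of `Ψ_e`. [this work] -/
theorem Mk_update_clU (κ : Fin 5 → Fin 5 → Fin 5 → ℝ) (lab : Finset E → Fin 5) (ω : E → Pat → ℝ) (e : E) :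
    Mk κ lab (Function.update ω e clU) = Psi κ lab ω e Pat.full := by
  rw [Mk_update_eq_sum]
  simp only [clU, ite_mul, one_mul, zero_mul, sum_ite_eq', mem_univ, if_true]

/-- The three singleton patterns. [this work] -/
theorem sum_cl1_const (c : ℝ) : ∑ B : Pat, cl1 B * c = 3 * c := by
  rw [← sum_mul]
  congr 1
  simp only [cl1, Pat.isSingle, Fintype.sum_prod_type, Fintype.sum_bool]
  norm_num

/-- **DELETE**: with `e` a partition coordinate of the labelling `lab ∘ erase e`, the functional is three times the `e`-deleted functional. [this work] -/
theorem Mk_erase_cl1 (κ : Fin 5 → Fin 5 → Fin 5 → ℝ) (lab : Finset E → Fin 5) (ω : E → Pat → ℝ) (e : E) :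
    Mk κ (fun S => lab (S.erase e)) (Function.update ω e cl1) = 3 * Mk κ lab (Function.update ω e cl0) := by
  rw [Mk_update_eq_sum, Mk_update_cl0]
  have h : ∀ B : Pat, Psi κ (fun S => lab (S.erase e)) ω e B = Psi κ lab ω e Pat.nil := by
    intro B
    unfold Psi
    refine sum_congr rfl fun β _ => ?_
    split_ifs with hβ
    · dsimp only
      rw [erase_blocks_update hβ, erase_blocks_update hβ, erase_blocks_update hβ,
        blocks_update_empty hβ, blocks_update_empty hβ, blocks_update_empty hβ]
    · rfl
  simp_rw [h]
  exact sum_cl1_const _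

/-- **CONTRACT**: with `e` a partition coordinate of the labelling `lab ∘ insert e`, the functional is three times the `e`-contracted functional. [this work] -/
theorem Mk_insert_cl1 (κ : Fin 5 → Fin 5 → Fin 5 → ℝ) (lab : Finset E → Fin 5) (ω : E → Pat → ℝ) (e : E) :
    Mk κ (fun S => lab (insert e S)) (Function.update ω e cl1) = 3 * Mk κ lab (Function.update ω e clU) := by
  rw [Mk_update_eq_sum, Mk_update_clU]
  have h : ∀ B : Pat, Psi κ (fun S => lab (insert e S)) ω e B = Psi κ lab ω e Pat.full := by
    intro B
    unfold Psi
    refine sum_congr rfl fun β _ => ?_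
    split_ifs with hβ
    · dsimp only
      rw [insert_blocks_update hβ, insert_blocks_update hβ, insert_blocks_update hβ]
    · rfl
  simp_rw [h]
  exact sum_cl1_const _

/-! ### Duplicate: a twin `none` of the coordinate `e`, on `Option E` -/

/-- The configuration of `E` seen by a configuration of `Option E` when `none` is a twin (OR-clone) of `e`. [this work] -/
def mergeOpt (e : E) (S : Finset (Option E)) : Finset E := univ.filter fun x => some x ∈ S ∨ (x = e ∧ none ∈ S)

omit [DecidableEq E] in
/-- `mergeOpt` is monotone. [this work] -/
theorem mergeOpt_mono [DecidableEq E] (e : E) : Monotone (mergeOpt e) := by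
  intro S T hST x hx
  simp only [mergeOpt, mem_filter, mem_univ, true_and] at hx ⊢
  rcases hx with h | ⟨h1, h2⟩
  · exact Or.inl (hST h)
  · exact Or.inr ⟨h1, hST h2⟩

/-- Merging the blocks of a pattern assignment on `Option E`: the twin's pattern is united with `e`'s. [this work] -/
theorem mergeOpt_blocks (e : E) (B : Pat) (δ : E → Pat) (k : Fin 3) :
    mergeOpt e (blocks (fun o : Option E => o.elim B δ) k) = blocks (Function.update δ e (B.union (δ e))) k := by
  ext x
  by_cases hx : x = e
  · subst hx
    simp [mergeOpt, or_comm]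
  · simp [mergeOpt, hx]

/-- Weights on `Option E`: `w₁` on the twin `none`, `w₂` on `e`, `ω` elsewhere. [this work] -/
def dupW (ω : E → Pat → ℝ) (e : E) (w₁ w₂ : Pat → ℝ) : Option E → Pat → ℝ :=
  fun o => o.elim w₁ (Function.update ω e w₂)

/-- Pattern assignments on `Option E` are pairs (pattern of `none`, assignment on `E`). [this work] -/
theorem sum_optionFun (f : (Option E → Pat) → ℝ) :
    ∑ γ : Option E → Pat, f γ = ∑ q : Pat × (E → Pat), f (fun o => o.elim q.1 q.2) := by
  refine (Fintype.sum_bijective (fun q : Pat × (E → Pat) => fun o : Option E => o.elim q.1 q.2) ⟨?_, ?_⟩ _ _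
    (fun _ => rfl)).symm
  · intro q q' h
    have h1 : q.1 = q'.1 := by simpa using congrFun h none
    have h2 : q.2 = q'.2 := by funext x; simpa using congrFun h (some x)
    exact Prod.ext h1 h2
  · intro γ
    exact ⟨(γ none, fun x => γ (some x)), by funext o; cases o <;> rfl⟩

/-- **DUPLICATE**: a twin of `e` weighted `w₁`, with `e` weighted `w₂`, is the coordinate `e` weighted by the union-convolution `uconv w₁ w₂`. [this work] -/
theorem Mk_dup (κ : Fin 5 → Fin 5 → Fin 5 → ℝ) (lab : Finset E → Fin 5) (ω : E → Pat → ℝ) (e : E) (w₁ w₂ : Pat → ℝ) :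
    Mk κ (fun S => lab (mergeOpt e S)) (dupW ω e w₁ w₂) = Mk κ lab (Function.update ω e (uconv w₁ w₂)) := by
  -- right-hand side: Σ_{B₁,B₂} w₁ B₁ w₂ B₂ Ψ(B₁ ∪ B₂)
  rw [Mk_update_eq_sum]
  have rhs : ∑ B : Pat, uconv w₁ w₂ B * Psi κ lab ω e B =
      ∑ x : Pat × Pat, w₁ x.1 * w₂ x.2 * Psi κ lab ω e (x.1.union x.2) := by
    simp only [uconv, sum_mul]
    rw [sum_comm]
    refine sum_congr rfl fun x _ => ?_
    simp only [ite_mul, zero_mul]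
    rw [sum_ite_eq, if_pos (mem_univ _)]
  rw [rhs, Fintype.sum_prod_type]
  -- left-hand side
  unfold Mk
  rw [sum_optionFun, Fintype.sum_prod_type]
  refine sum_congr rfl fun B₁ _ => ?_
  -- inner sum over δ : E → Pat ; single out δ e
  have inner : ∀ δ : E → Pat, (∏ o : Option E, dupW ω e w₁ w₂ o ((fun o : Option E => o.elim B₁ δ) o)) *
      κ (lab (mergeOpt e (blocks (fun o : Option E => o.elim B₁ δ) 0)))
        (lab (mergeOpt e (blocks (fun o : Option E => o.elim B₁ δ) 1)))
        (lab (mergeOpt e (blocks (fun o : Option E => o.elim B₁ δ) 2))) =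
      ∑ B₂ : Pat, if δ e = B₂ then w₁ B₁ * w₂ B₂ * ((∏ x ∈ univ.erase e, ω x (δ x)) *
        κ (lab (blocks (Function.update δ e (B₁.union B₂)) 0)) (lab (blocks (Function.update δ e (B₁.union B₂)) 1))
          (lab (blocks (Function.update δ e (B₁.union B₂)) 2))) else 0 := by
    intro δ
    rw [sum_ite_eq, if_pos (mem_univ _), Fintype.prod_option, mergeOpt_blocks, mergeOpt_blocks, mergeOpt_blocks]
    simp only [dupW, Option.elim_none, Option.elim_some]
    rw [prod_update_eval]
    ring
  rw [sum_congr rfl fun δ _ => inner δ, sum_comm]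
  refine sum_congr rfl fun B₂ _ => ?_
  rw [sum_ite_update _ e B₂ Pat.nil]
  unfold Psi
  rw [mul_sum]
  refine sum_congr rfl fun δ _ => ?_
  split_ifs with hδ
  · rw [Function.update_idem]
    have hR : ∏ x ∈ univ.erase e, ω x (Function.update δ e B₂ x) = ∏ x ∈ univ.erase e, ω x (δ x) :=
      prod_congr rfl fun x hx => by rw [Function.update_of_ne (ne_of_mem_erase hx)]
    rw [hR]
  · simp

end Functional

end Summit.CriticalPhenomena.PercolationContinuityZ3.Theorems.SunflowerPartition
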